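import Literature.Geometry.Lorentzian.LeviCivitaProofs
import Literature.Geometry.Lorentzian.CurvatureSymmetries
import Literature.Geometry.Riemannian.NonTrappingConvexSublevelProofs
import HarnessLib

/-!
# The Hessian of a smooth function on a compact Riemannian manifold is bounded

Support file for the discharge of
`Literature.Geometry.Riemannian.ggsu_boundary_sphere_of_nonTrapping_of_nonpos`
(`SimpleAHBoundarySphere.lean`): on a compact manifold (any model, boundary allowed) with a smooth
positive definite metric `g` and a smooth function `f`, there is a constant `A` with
`Hess^g f_z(w, w) ≤ A g_z(w, w)` for all tangent vectors — continuity of the Hessian quadratic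
form on `TM` (local frames, `hessian_apply_holds`) and compactness of the unit sphere bundle
(`isCompact_unitTangent`). Everything is proved; no definitions, no named facts.

## References

* B. O'Neill, *Semi-Riemannian geometry with applications to relativity*, Academic Press 1983,
  Ch. 3, Def. 3.48–Lemma 3.49 (Hessian). [ONeill1983]
* J. M. Lee, *Introduction to Riemannian Manifolds*, 2nd ed. (2018), Lemma 6.19 (compactness of
  the unit tangent bundle over a compact set). [LeeRiemannianManifolds2018]
-/

noncomputable section

open Bundle Set NormedSpace FiberBundle VectorField
open scoped Manifold ContDiff Topology

namespace Literature.Geometry.Riemannian.GGSU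

open Literature.Geometry.Lorentzian
open Literature.Geometry.Lorentzian.PseudoRiemannianMetric

variable {E : Type*} [NormedAddCommGroup E] [NormedSpace ℝ E] {H : Type*} [TopologicalSpace H]
  {I : ModelWithCorners ℝ E H} {M : Type*} [TopologicalSpace M] [ChartedSpace H M]
  [IsManifold I ∞ M] {x : M}

/-- For `f : M → ℝ` of class `C^{m+1}` at `x` and a vector field `W` of class `C^m` at `x`, the
function `W f : y ↦ df_y(W_y)` is `C^m` at `x` (general-exponent form of the tree's
`contMDiffAt_mvfderiv_apply`). [folklore] -/
theorem contMDiffAt_mvfderiv_apply_of_le {m : ℕ∞ω} {f : M → ℝ} {W : Π x : M, TangentSpace I x}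
    (hf : CMDiffAt (m + 1) f x) (hW : CMDiffAt m (T% W) x) :
    CMDiffAt m (fun y ↦ mvfderiv I f y (W y)) x := by
  have h1 : CMDiffAt m (inTangentCoordinates I 𝓘(ℝ, ℝ) id f (mfderiv% f) x) x :=
    hf.mfderiv_const le_rfl
  have h2 : CMDiffAt m (fun y ↦ (mfderiv% f y (W y) :
      TotalSpace ℝ (TangentSpace 𝓘(ℝ, ℝ) : ℝ → Type _))) x :=
    ContMDiffAt.clm_apply_of_inCoordinates (b₁ := id) (b₂ := f) h1 hW (hf.of_le le_self_add)
  exact ((contMDiff_snd_tangentBundle_modelSpace ℝ 𝓘(ℝ, ℝ) (n := m)).contMDiffAt).comp x h2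

variable [FiniteDimensional ℝ E] [CompleteSpace E]
  (g : PseudoRiemannianMetric I ∞ E (TangentSpace I : M → Type _)) [g.HasLeviCivita]

/-- The Hessian of a smooth function, evaluated on two smooth vector fields, is a smooth function
on any open set where the fields are smooth (`hessian_apply_holds` and smoothness of the
Levi-Civita connection). [cite: ONeill1983, Ch. 3, Def. 3.48–Lemma 3.49] -/
theorem contMDiffOn_hessian_apply {f : M → ℝ} (hf : CMDiff ∞ f) {O : Set M} (hO : IsOpen O)
    {X Y : Π x : M, TangentSpace I x} (hX : CMDiff[O] ∞ (T% X)) (hY : CMDiff[O] ∞ (T% Y)) :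
    ContMDiffOn I 𝓘(ℝ, ℝ) ∞ (fun z ↦ g.hessian f z (X z) (Y z)) O := by
  have hcov : g.leviCivita.IsLocallyContMDiff ∞ :=
    g.isLocallyContMDiff_leviCivita_holds ⊤ (le_refl _)
  -- the field `z ↦ ∇_{X z} Y`
  have hV : CMDiff[O] ∞ (T% (fun z ↦ g.leviCivita Y z (X z))) :=
    ((hcov O hO).contMDiff (hY.of_le (by exact_mod_cast le_top))).clm_bundle_apply hX
  have hYf : ContMDiffOn I 𝓘(ℝ, ℝ) ∞ (fun y ↦ mvfderiv I f y (Y y)) O := fun z hz ↦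
    (contMDiffAt_mvfderiv_apply_of_le (m := ∞) (hf z)
      ((hY z hz).contMDiffAt (hO.mem_nhds hz))).contMDiffWithinAt
  have h1 : ContMDiffOn I 𝓘(ℝ, ℝ) ∞
      (fun z ↦ mvfderiv I (fun y ↦ mvfderiv I f y (Y y)) z (X z)) O := fun z hz ↦
    (contMDiffAt_mvfderiv_apply_of_le (m := ∞) ((hYf z hz).contMDiffAt (hO.mem_nhds hz))
      ((hX z hz).contMDiffAt (hO.mem_nhds hz))).contMDiffWithinAt
  have h2 : ContMDiffOn I 𝓘(ℝ, ℝ) ∞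
      (fun z ↦ mvfderiv I f z (g.leviCivita Y z (X z))) O := fun z hz ↦
    (contMDiffAt_mvfderiv_apply_of_le (m := ∞) (hf z)
      ((hV z hz).contMDiffAt (hO.mem_nhds hz))).contMDiffWithinAt
  refine (h1.sub h2).congr fun z hz ↦ ?_
  have hXz : MDiffAt (T% X) z := ((hX z hz).contMDiffAt (hO.mem_nhds hz)).mdifferentiableAt (by simp)
  have hYz : MDiffAt (T% Y) z := ((hY z hz).contMDiffAt (hO.mem_nhds hz)).mdifferentiableAt (by simp)
  rw [g.hessian_apply_holds ((hf z).of_le (WithTop.coe_le_coe.mpr le_top)) hXz hYz]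
  rfl

/-- **The Hessian quadratic form is continuous on the tangent bundle.** For a smooth metric and a
smooth function `f`, `(z, w) ↦ Hess^g f_z(w, w)` is continuous on `TM` (expand `w` in the local
frame of a trivialisation; the coefficients are continuous on its source and the frame Hessians
`Hess f(sᵢ, sⱼ)` are smooth functions of the base point). [folklore] -/
theorem continuous_hessian_quadratic {f : M → ℝ} (hf : CMDiff ∞ f) :
    Continuous fun p : TangentBundle I M ↦ g.hessian f p.proj p.2 p.2 := by
  classical
  refine continuous_iff_continuousAt.2 fun p₀ ↦ ?_
  set e := trivializationAt E (TangentSpace I : M → Type _) p₀.proj with he_def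
  have hx₀ : p₀.proj ∈ e.baseSet := FiberBundle.mem_baseSet_trivializationAt' p₀.proj
  set b := Module.finBasis ℝ E with hb_def
  -- the frame Hessians
  have hfr : ∀ i, CMDiff[e.baseSet] ∞ (T% (e.localFrame b i)) := fun i ↦
    e.contMDiffOn_localFrame_baseSet (I := I) ∞ b i
  have hH : ∀ i j, ContinuousOn (fun z ↦ g.hessian f z (e.localFrame b i z) (e.localFrame b j z))
      e.baseSet := fun i j ↦
    (contMDiffOn_hessian_apply g hf e.open_baseSet (hfr i) (hfr j)).continuousOn
  -- the coefficient functions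
  set c : Fin (Module.finrank ℝ E) → TangentBundle I M → ℝ := fun i p ↦ b.repr (e p).2 i with hc_def
  have hc : ∀ i, ContinuousOn (c i) e.source := fun i ↦ by
    have h1 : ContinuousOn (fun p : TangentBundle I M ↦ (e p).2) e.source :=
      continuous_snd.comp_continuousOn e.continuousOn
    exact ((b.coord i).continuous_of_finiteDimensional).comp_continuousOn h1
  -- the local formula
  set Q : TangentBundle I M → ℝ := fun p ↦
    ∑ i, ∑ j, c i p * c j p * g.hessian f p.proj (e.localFrame b i p.proj) (e.localFrame b j p.proj)
    with hQ_def
  have hsrc : e.source ∈ 𝓝 p₀ := e.open_source.mem_nhds (by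
    rw [e.source_eq]; exact hx₀)
  have hQc : ContinuousAt Q p₀ := by
    have hproj : ∀ p ∈ e.source, p.proj ∈ e.baseSet := fun p hp ↦ by
      rwa [e.source_eq] at hp
    have : ContinuousOn Q e.source := by
      refine continuousOn_finsetSum _ fun i _ ↦ continuousOn_finsetSum _ fun j _ ↦ ?_
      refine ((hc i).mul (hc j)).mul ?_
      exact (hH i j).comp (FiberBundle.continuous_proj E (TangentSpace I)).continuousOn hproj
    exact this.continuousAt hsrc
  refine hQc.congr (Filter.mem_of_superset hsrc fun p hp ↦ ?_)
  have hpx : p.proj ∈ e.baseSet := by rwa [e.source_eq] at hp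
  -- expand `p.2` in the frame at `p.proj`
  have hexp : p.2 = ∑ i, c i p • e.localFrame b i p.proj := by
    have h := Trivialization.eq_sum_localFrame_coeff_smul (I := I) (e := e) (b := b)
      (s := extend E p.2) hpx
    have hcoef : ∀ i, e.localFrame_coeff I b i p.proj (extend E p.2 p.proj) = c i p := by
      intro i
      rw [e.localFrame_coeff_apply_of_mem_baseSet b hpx (extend E p.2) i, extend_apply_self]
      simp only [hc_def, Trivialization.basisAt, Module.Basis.map_repr, LinearEquiv.trans_apply,
        LinearEquiv.symm_symm, Trivialization.linearEquivAt_apply]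
    simp only [hcoef] at h
    rwa [extend_apply_self] at h
  show Q p = g.hessian f p.proj p.2 p.2
  set B := g.hessian f p.proj with hB
  set sf := fun i ↦ e.localFrame b i p.proj with hsf
  have hexp' : p.2 = ∑ i, c i p • sf i := hexp
  have key : B (∑ i, c i p • sf i) (∑ j, c j p • sf j) = ∑ i, ∑ j, c i p * c j p * B (sf i) (sf j) := by
    rw [LinearMap.map_sum₂]
    refine Finset.sum_congr rfl fun i _ ↦ ?_
    rw [LinearMap.map_smul₂, map_sum, smul_eq_mul, Finset.mul_sum]
    refine Finset.sum_congr rfl fun j _ ↦ ?_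
    rw [map_smul, smul_eq_mul]
    ring
  rw [hexp', key]

/-- **The Hessian of a smooth function on a compact Riemannian manifold is bounded by the
metric**: there is `A` with `Hess^g f_z(w, w) ≤ A g_z(w, w)` for all `z, w` (continuity on the
compact unit sphere bundle and homogeneity). [folklore] -/
theorem exists_hessian_le_mul_val [T2Space M] [CompactSpace M] (hg : g.IsRiemannian)
    {f : M → ℝ} (hf : CMDiff ∞ f) :
    ∃ A : ℝ, 0 ≤ A ∧ ∀ (z : M) (w : TangentSpace I z), g.hessian f z w w ≤ A * g.val z w w := by
  have hK := isCompact_unitTangent g hg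
  obtain ⟨A, hA⟩ := hK.bddAbove_image (continuous_hessian_quadratic g hf).continuousOn
  refine ⟨max A 0, le_max_right _ _, fun z w ↦ ?_⟩
  by_cases hw : w = 0
  · subst hw; simp
  have hpos : 0 < g.val z w w := hg z w hw
  set t := Real.sqrt (g.val z w w) with ht_def
  have ht : 0 < t := Real.sqrt_pos.2 hpos
  have htt : t * t = g.val z w w := Real.mul_self_sqrt hpos.le
  set w₁ : TangentSpace I z := t⁻¹ • w with hw₁
  have hunit : g.val z w₁ w₁ = 1 := by
    simp only [hw₁, map_smul, FunLike.coe_smul, Pi.smul_apply, smul_eq_mul]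
    rw [← htt]; field_simp
  have h1 : g.hessian f z w₁ w₁ ≤ A := by
    refine hA ⟨⟨z, w₁⟩, ?_, rfl⟩
    exact hunit
  have hww : w = t • w₁ := by
    simp only [hw₁, smul_smul, mul_inv_cancel₀ ht.ne', one_smul]
  have h2 : g.hessian f z w w = t * t * g.hessian f z w₁ w₁ := by
    conv_lhs => rw [hww]
    simp only [map_smul, LinearMap.smul_apply, smul_eq_mul]
    ring
  rw [h2, ← htt]
  have : t * t * g.hessian f z w₁ w₁ ≤ t * t * A :=
    mul_le_mul_of_nonneg_left h1 (mul_self_nonneg t)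
  nlinarith [le_max_left A 0, mul_self_nonneg t]

end Literature.Geometry.Riemannian.GGSU
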